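import Literature.NumberTheory.DiophantineGeometry.LocalReduction
import HarnessLib

/-!
# Good reduction of a Weierstrass curve at a finite place — the predicate is not universally true

`WeierstrassCurve.HasGoodReductionAt v W` (stated in
`Literature.NumberTheory.DiophantineGeometry.LocalReduction`) is a *definition* — the notion "`W / K`
has good reduction at the finite place `v`", i.e. the chosen local minimal model at `v` has `v`-unit
discriminant (Silverman, AEC VII.5, Definition and Prop. 5.1(a), PDF p. 174: "good reduction iff
`v(Δ) = 0`, i.e. `Δ ∈ R^*`; in this case `Ẽ/k` is an elliptic curve"). It is a two-argument
predicate, not a named fact, so there is no `HasGoodReductionAt_holds`: this file records the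
(elementary) formal reason, kept in its own sibling file so as not to interfere with the discharges
of the neighbouring named facts in `LocalReductionProofs` and `LocalReductionGoodReductionProofs`.

* `WeierstrassCurve.HasGoodReductionAt.Δ_ne_zero`, `WeierstrassCurve.HasGoodReductionAt.isElliptic`:
  good reduction at some finite place forces `Δ ≠ 0`, i.e. `W` is an elliptic curve (the local
  minimal model is `E • W_{K_v}` for a change of variables `E` over `K_v`, with discriminant
  `u⁻¹² · Δ`, and a `v`-unit is non-zero).
* `WeierstrassCurve.not_forall_hasGoodReductionAt`: at every finite place `v` the cuspidal equation
  `y² = x³` (all `aᵢ = 0`, `Δ = 0`) does not have good reduction; compare Silverman, AEC VII.5,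
  Example 5.2 (`y² = x³ + p` has additive, hence not good, reduction over `ℚ_p`).

## References

* J. H. Silverman, *The Arithmetic of Elliptic Curves*, GTM 106, 2nd ed. 2009, §VII.1 (Definition of a
  minimal equation and Prop. 1.3(b), PDF p. 165) and §VII.5 (Definition, Prop. 5.1(a) and Example 5.2,
  PDF p. 174).
-/

open IsDedekindDomain

namespace WeierstrassCurve

section NonUniversal

variable {A : Type*} [CommRing A] [IsDedekindDomain A] {K : Type*} [Field K]
  [Algebra A K] [IsFractionRing A K] {v : HeightOneSpectrum A} {W : WeierstrassCurve K}

/-- Good reduction at `v` forces `Δ ≠ 0`: the chosen local minimal model has `v`-unit discriminant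
`u⁻¹² · Δ`, so `Δ ≠ 0`. Silverman, AEC VII.5, Prop. 5.1(a) ("good reduction iff `v(Δ) = 0`, i.e.
`Δ ∈ R^*`; in this case `Ẽ/k` is an elliptic curve"). [cite: SilvermanAEC2009, VII.5 Prop. 5.1(a) (PDF p. 174)] -/
theorem HasGoodReductionAt.Δ_ne_zero (h : W.HasGoodReductionAt v) : W.Δ ≠ 0 := by
  intro hΔ
  have h1 := h.goodReduction
  obtain ⟨E, hE⟩ : ∃ E : VariableChange (v.adicCompletion K),
      W.localMinimalModel v = E • W.baseChange (v.adicCompletion K) := ⟨_, rfl⟩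
  rw [hE, variableChange_Δ] at h1
  simp only [WeierstrassCurve.baseChange, map_Δ, hΔ, map_zero, mul_zero] at h1
  exact zero_ne_one h1

/-- Good reduction at some finite place implies that `W` is an elliptic curve (`Δ` is a unit of the
field `K`). Silverman, AEC VII.5, Prop. 5.1(a). [cite: SilvermanAEC2009, VII.5 Prop. 5.1(a) (PDF p. 174)] -/
theorem HasGoodReductionAt.isElliptic (h : W.HasGoodReductionAt v) : W.IsElliptic :=
  W.isElliptic_iff.mpr (isUnit_iff_ne_zero.mpr h.Δ_ne_zero)

variable (v) in
/-- The predicate `WeierstrassCurve.HasGoodReductionAt v` is a *definition* (the notion "good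
reduction at `v`"), not a universally valid statement: at every finite place `v` the cuspidal
equation `y² = x³` (all `aᵢ = 0`, `Δ = 0`) does not have good reduction. (So no
`HasGoodReductionAt_holds : ∀ v W, W.HasGoodReductionAt v` can exist.) Compare Silverman, AEC VII.5,
Example 5.2 (`y² = x³ + p` has additive reduction over `ℚ_p`). [cite: SilvermanAEC2009, VII.5 Prop. 5.1(a) and Example 5.2 (PDF p. 174)] -/
theorem not_forall_hasGoodReductionAt :
    ¬ ∀ W : WeierstrassCurve K, W.HasGoodReductionAt v := fun h ↦
  (h ⟨0, 0, 0, 0, 0⟩).Δ_ne_zero (by simp [Δ, b₂, b₄, b₆, b₈])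

end NonUniversal

end WeierstrassCurve
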